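import Summits.RiemannHypothesis.RiemannHypothesis.Theorems.TiltedLandingLaw421R3FLinkGainSeam

/-!
# SegmentMVT (C4 «kernel desk» rh-idea-6 g42, W-09 F-LINK) — (P1) of C3's closure map, PROVED as kernel lemmas over the tree's `lineRem` / `linePt` (a CONTENT piece, not a door; C4 asks no token — the director judges)

C3 g53 LOWGAIN §4 (P1): «gain ≤ |δ|·sup_{[p₀,w]} |∂ₓ(far field)| — the segment identity».  This scratch types and PROVES it over the tree's own
objects (`RhW08.FLinkGain.lineRem`, `RhW08.FLink.linePt`), with the two facts that make the mean-value inequality applicable on the horizontal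
segment `[p₀, w]` (`p₀ = linePt v w = Re v + i·Im w`):
* `iteratedDeriv_ne_zero_of_mem_segment` (K): `f⁽ʲ⁾` has no zero on `[p₀, w]` for a MOVING child `w` of the closed axis disc (isolation ⇒ a zero
  there is `v` or `v̄`; `v̄` has the wrong sign; `v` forces `w = v`) — the segment version of the tree's `RhW08.FLinkGain.iteratedDeriv_linePt_ne_zero`;
* `differentiableAt_lineRem` (K): `lineRem f j v R` is ℂ-differentiable at every point where `f⁽ʲ⁾ ≠ 0` off `{v, v̄}` (closed form `lineRem_eq`);
* ★ `norm_lineRem_sub_linePt_le` (K, (P1)): `‖lineRem w − lineRem p₀‖ ≤ C·|Re w − Re v|` for any bound `C` of `‖deriv (lineRem f j v R)‖` on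
  `[p₀, w]` (`Convex.norm_image_sub_le_of_norm_deriv_le` on `segment ℝ p₀ w`);
* `gain_of_segment_deriv_bound` (K): hence the gain-law conclusion `‖lineRem w‖ ≤ ‖lineRem p₀‖ + θ·η/s` from `C·|Re w − Re v| ≤ θ·η/s`.
No new socket, no door: these are the analytic facts a proof of `RhW08.FLinkGainSeam.RemainderGainBoxSeamSig θ` on any regime starts from
((P2) = Cauchy–Schwarz on the derivative's far polar sum and (P3) = the cone-ratio bound are the next kernel steps; (P4)/(P5′) carry the law).
Nothing here bears on the truth of RH; ⟨33346⟩/⟨33347⟩ OPEN.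
-/

namespace RhW08.GainSegment

open Complex Filter Topology
open scoped ComplexConjugate
open RhW08.Round1 RhW08.StSwap RhW08.Round2 RhW08.QuadW
open RhW08.SealSwap (PBot)
open RhW08.SealSwapQ RhW08.RateSplit RhW08.IsolatedTilt RhW08.FarStep RhW08.BurgersRate RhW08.PurseP RhW08.BurgersRateG3
open RhIdea6.G17.W07C7 RhIdea6.G17.W07C7.Rev6 RhIdea6.G18.W07C8.Law421BirthS RhIdea6.G19.W07C11.Seam
open RhIdea6.G20.W07C12.Frac RhIdea6.G20.W07C12.StColP RhW07.C12.FieldSplit RhIdea6.G21.W07C13.TentMax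
open RhW07.C14.TwoSided RhW07.C14.Classes RhW07.C14.Lineage RhW07.C14.Booking
open RhW08.FLink RhW08.FLinkGain RhW08.FLinkGainSeam

/-! ## The horizontal segment `[p₀, w]` -/

/-- every point of the segment `[p₀, w]` sits at the child's height `Im w`. -/
theorem im_eq_of_mem_segment {v w p : ℂ} (hp : p ∈ segment ℝ (linePt v w) w) : p.im = w.im := by
  obtain ⟨a, b, -, -, hab, rfl⟩ := hp
  simp only [Complex.add_im, Complex.smul_im, linePt_im, smul_eq_mul]
  calc a * w.im + b * w.im = (a + b) * w.im := by ring
    _ = w.im := by rw [hab, one_mul]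

/-- every point of the segment `[p₀, w]` is horizontally no farther from the axis `Re v` than the child. -/
theorem abs_re_sub_le_of_mem_segment {v w p : ℂ} (hp : p ∈ segment ℝ (linePt v w) w) : |p.re - v.re| ≤ |w.re - v.re| := by
  obtain ⟨a, b, ha0, hb, hab, rfl⟩ := hp
  simp only [Complex.add_re, Complex.smul_re, linePt_re, smul_eq_mul]
  have ha : a = 1 - b := by linarith
  have h : a * v.re + b * w.re - v.re = b * (w.re - v.re) := by rw [ha]; ring
  rw [h, abs_mul, abs_of_nonneg hb]
  calc b * |w.re - v.re| ≤ 1 * |w.re - v.re| := mul_le_mul_of_nonneg_right (by linarith) (abs_nonneg _)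
    _ = |w.re - v.re| := one_mul _

/-- the child's horizontal offset is at most the disc radius: `|Re w − Re v| ≤ ‖w − Re v‖ ≤ |Im v|`. -/
theorem abs_re_sub_le_abs_im {v w : ℂ} (hd : ‖w - (v.re : ℂ)‖ ≤ |v.im|) : |w.re - v.re| ≤ |v.im| := by
  have h : |(w - (v.re : ℂ)).re| ≤ ‖w - (v.re : ℂ)‖ := Complex.abs_re_le_norm _
  simp only [Complex.sub_re, Complex.ofReal_re] at h
  exact h.trans hd

/-- on a legal frame a child of a lowest state in the box has `|Re w − Re v| < R/2` (`|Re w − Re v| ≤ Im v ≤ hmax < R/3`). -/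
theorem abs_re_sub_lt_half {v w : ℂ} {hmax R : ℝ} (hd : ‖w - (v.re : ℂ)‖ ≤ |v.im|) (hv0 : 0 < v.im) (hh : v.im ≤ hmax)
    (h3 : 3 * hmax < R) : |w.re - v.re| < R / 2 := by
  have h1 := abs_re_sub_le_abs_im hd
  rw [abs_of_pos hv0] at h1
  linarith

/-- length of the segment: `‖w − p₀‖ = |Re w − Re v|`. -/
theorem norm_sub_linePt (v w : ℂ) : ‖w - linePt v w‖ = |w.re - v.re| := by
  have h : w - linePt v w = ((w.re - v.re : ℝ) : ℂ) := Complex.ext (by simp [linePt]) (by simp [linePt])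
  rw [h, Complex.norm_real, Real.norm_eq_abs]

/-! ## No zero of `f⁽ʲ⁾` on the segment; differentiability of the line remainder -/

/-- (K) `f⁽ʲ⁾` does not vanish on the segment `[p₀, w]` of a MOVING child `w` (`f⁽ʲ⁾ w ≠ 0`, `0 < Im w`) of the closed axis disc, provided the
child's offset stays inside `v`'s window (`|Re w − Re v| < R/2`): by isolation a zero there is `v` or `v̄`; `v̄` has the wrong sign; `v` would put the
segment at height `Im v`, i.e. the child at the top of the disc, `w = v`. -/
theorem iteratedDeriv_ne_zero_of_mem_segment {f : ℂ → ℂ} {j : ℕ} {v w p : ℂ} {R : ℝ}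
    (hiso : ∀ z : ℂ, iteratedDeriv j f z = 0 → |z.re - v.re| < R / 2 → z = v ∨ z = conj v)
    (hv0 : 0 < v.im) (hwim : 0 < w.im) (hd : ‖w - (v.re : ℂ)‖ ≤ |v.im|) (hw : iteratedDeriv j f w ≠ 0)
    (hδ : |w.re - v.re| < R / 2) (hp : p ∈ segment ℝ (linePt v w) w) :
    iteratedDeriv j f p ≠ 0 := by
  intro h0
  have hre : |p.re - v.re| < R / 2 := (abs_re_sub_le_of_mem_segment hp).trans_lt hδ
  have hpim : p.im = w.im := im_eq_of_mem_segment hp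
  rcases hiso _ h0 hre with h | h
  · have him : w.im = v.im := by rw [← hpim, h]
    have h1 := sq_disc_of_norm_le hd
    rw [him] at h1
    have h2 : (w.re - v.re) ^ 2 = 0 := le_antisymm (by linarith) (sq_nonneg _)
    have hre0 : w.re = v.re := sub_eq_zero.mp ((pow_eq_zero_iff two_ne_zero).mp h2)
    have hwv : w = v := Complex.ext hre0 him
    apply hw
    rw [hwv, ← h]
    exact h0
  · have him : w.im = -v.im := by rw [← hpim, h, Complex.conj_im]
    linarith

/-- (K) the line remainder is ℂ-differentiable at every point `p ∉ {v, v̄}` with `f⁽ʲ⁾ p ≠ 0` (closed form `RhW08.FLinkGain.lineRem_eq`: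
`φ_j = f⁽ʲ⁺¹⁾/f⁽ʲ⁾` minus two simple poles). -/
theorem differentiableAt_lineRem {η : ℝ} {f : ℂ → ℂ} {x₀ s hmax R Hs : ℝ} {B : ℕ} (hE : EngineHyps5 2 η f x₀ s hmax R Hs B)
    {j : ℕ} {v p : ℂ} (hiso : ∀ z : ℂ, iteratedDeriv j f z = 0 → |z.re - v.re| < R / 2 → z = v ∨ z = conj v)
    (hFv : iteratedDeriv j f v = 0) (hv0 : 0 < v.im) (hp0 : iteratedDeriv j f p ≠ 0) (hpv : p ≠ v) (hpc : p ≠ conj v) :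
    DifferentiableAt ℂ (lineRem f j v R) p := by
  have hR := RhW08.ClusterQ.R_pos_of_engine hE
  have hFcv : iteratedDeriv j f (conj v) = 0 := by rw [iteratedDeriv_conj hE, hFv, map_zero]
  set m : ℂ := ((analyticOrderAt (iteratedDeriv j f) v).toNat : ℂ) with hm
  set m' : ℂ := ((analyticOrderAt (iteratedDeriv j f) (conj v)).toNat : ℂ) with hm'
  have hfun : lineRem f j v R = fun q => iteratedDeriv (j + 1) f q / iteratedDeriv j f q - (m * (q - v)⁻¹ + m' * (q - conj v)⁻¹) := by
    funext q
    rw [lineRem_eq hiso hFv hFcv hR hv0 q]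
    rfl
  rw [hfun]
  have hpv' : p - v ≠ 0 := sub_ne_zero.mpr hpv
  have hpc' : p - conj v ≠ 0 := sub_ne_zero.mpr hpc
  have h1 : DifferentiableAt ℂ (fun q => iteratedDeriv (j + 1) f q / iteratedDeriv j f q) p :=
    ((differentiable_level hE (j + 1)) p).fun_div ((differentiable_level hE j) p) hp0
  have h2 : DifferentiableAt ℂ (fun q => m * (q - v)⁻¹ + m' * (q - conj v)⁻¹) p := by
    fun_prop (disch := assumption)
  exact h1.sub h2

/-! ## ★ (P1) the segment mean-value bound and the gain conclusion it feeds -/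

/-- ★ (K) **(P1) SEGMENT BOUND**: on a legal frame, for a lowest-type state `v` of level `j` in the box (`f⁽ʲ⁾ v = 0`, `0 < Im v ≤ hmax`,
`R/2`-isolated) and a MOVING child `w` of the closed axis disc (`f⁽ʲ⁾ w ≠ 0`, `0 < Im w`, `‖w − Re v‖ ≤ Im v`), any bound `C` of the derivative of the
line remainder on the segment `[p₀, w]` bounds the GAIN: `‖lineRem w − lineRem p₀‖ ≤ C · |Re w − Re v|`. -/
theorem norm_lineRem_sub_linePt_le {η : ℝ} {f : ℂ → ℂ} {x₀ s hmax R Hs : ℝ} {B : ℕ} (hE : EngineHyps5 2 η f x₀ s hmax R Hs B)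
    {j : ℕ} {v w : ℂ} (hiso : ∀ z : ℂ, iteratedDeriv j f z = 0 → |z.re - v.re| < R / 2 → z = v ∨ z = conj v)
    (hFv : iteratedDeriv j f v = 0) (hv0 : 0 < v.im) (hh : v.im ≤ hmax)
    (hw : iteratedDeriv j f w ≠ 0) (hwim : 0 < w.im) (hd : ‖w - (v.re : ℂ)‖ ≤ |v.im|)
    {C : ℝ} (hC : ∀ p ∈ segment ℝ (linePt v w) w, ‖deriv (lineRem f j v R) p‖ ≤ C) :
    ‖lineRem f j v R w - lineRem f j v R (linePt v w)‖ ≤ C * |w.re - v.re| := by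
  have hE' := hE
  obtain ⟨_, _, _, _, _, _, h3, _, _, _, _, _, _, _, _, _⟩ := hE'
  have hδ : |w.re - v.re| < R / 2 := abs_re_sub_lt_half hd hv0 hh h3
  have hdiff : ∀ p ∈ segment ℝ (linePt v w) w, DifferentiableAt ℂ (lineRem f j v R) p := by
    intro p hp
    have hp0 : iteratedDeriv j f p ≠ 0 := iteratedDeriv_ne_zero_of_mem_segment hiso hv0 hwim hd hw hδ hp
    have hpv : p ≠ v := by
      intro h
      apply hp0
      rw [h]
      exact hFv
    have hpc : p ≠ conj v := by
      intro h
      have him := im_eq_of_mem_segment hp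
      rw [h, Complex.conj_im] at him
      linarith
    exact differentiableAt_lineRem hE hiso hFv hv0 hp0 hpv hpc
  have hmvt := (convex_segment (linePt v w) w).norm_image_sub_le_of_norm_deriv_le hdiff hC
    (left_mem_segment ℝ (linePt v w) w) (right_mem_segment ℝ (linePt v w) w)
  rwa [norm_sub_linePt] at hmvt

/-- (K) the GAIN-LAW CONCLUSION from a segment derivative budget: if `C` bounds `‖deriv lineRem‖` on `[p₀, w]` and `C·|Re w − Re v| ≤ θ·η/s`, then
`‖lineRem w‖ ≤ ‖lineRem p₀‖ + θ·η/s` — the consequent of `RhW08.FLinkGainSeam.RemainderGainBoxSeamSig θ` for this row. -/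
theorem gain_of_segment_deriv_bound {η : ℝ} {f : ℂ → ℂ} {x₀ s hmax R Hs : ℝ} {B : ℕ} (hE : EngineHyps5 2 η f x₀ s hmax R Hs B)
    {j : ℕ} {v w : ℂ} (hiso : ∀ z : ℂ, iteratedDeriv j f z = 0 → |z.re - v.re| < R / 2 → z = v ∨ z = conj v)
    (hFv : iteratedDeriv j f v = 0) (hv0 : 0 < v.im) (hh : v.im ≤ hmax)
    (hw : iteratedDeriv j f w ≠ 0) (hwim : 0 < w.im) (hd : ‖w - (v.re : ℂ)‖ ≤ |v.im|)
    {C θ : ℝ} (hC : ∀ p ∈ segment ℝ (linePt v w) w, ‖deriv (lineRem f j v R) p‖ ≤ C)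
    (hbudget : C * |w.re - v.re| ≤ θ * η / s) :
    ‖lineRem f j v R w‖ ≤ ‖lineRem f j v R (linePt v w)‖ + θ * η / s := by
  have h := norm_lineRem_sub_linePt_le hE hiso hFv hv0 hh hw hwim hd hC
  calc ‖lineRem f j v R w‖ = ‖lineRem f j v R (linePt v w) + (lineRem f j v R w - lineRem f j v R (linePt v w))‖ := by
        congr 1; ring
    _ ≤ ‖lineRem f j v R (linePt v w)‖ + ‖lineRem f j v R w - lineRem f j v R (linePt v w)‖ := norm_add_le _ _
    _ ≤ ‖lineRem f j v R (linePt v w)‖ + θ * η / s := by linarith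

end RhW08.GainSegment
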